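import Summits.Ventures.DiscreteObjects.UnitDistance.FiniteFieldLowerBounds
import Summits.Ventures.DiscreteObjects.UnitDistance.FiniteFieldLowerBoundF11
import Summits.Ventures.DiscreteObjects.UnitDistance.CoordRingObstruction
import Summits.Ventures.DiscreteObjects.UnitDistance.FiniteFieldLowerBoundF19
import Summits.Ventures.DiscreteObjects.UnitDistance.UnitQuadranceF27Hoffman
import HarnessLib

/-!
# The killer values of the (U) residue-field atlas — one kernel statement

Framing (verbatim for the cell): lottery ticket; floor = certified bounds/negative ranges.

Madore-type reduction (`ValuationRingReduction.lean`) bounds `χ(K²)` for a number field `K` by `χ(unitCircleGraph k)` for every residue field `k`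
with `−1` a non-square.  The census atlas (TABLE-U3 … U7) decides every such `k` except `F₂₇`: the 'killer' residue fields — those with
`χ(unitCircleGraph k) ≤ 5`, which force every unit-distance graph over `K` to be 5-colourable — are `F₃, F₇, F₁₁, F₁₉` (values 3, 4, 5, 5),
all other `q ≡ 3 (mod 4)` except `27` giving `χ ≥ 6` by SDP certificates (`p = 23, 31, 43, 47`) or by the Weil/Hoffman bound (`q ≥ 67`) and exact
spectra (`q = 243, 343`).  This file records, as ONE kernel theorem with standard axioms, the part of that sentence that is now kernel-exact:
the four killer values exactly (`FiniteFieldLowerBounds.lean`, `FiniteFieldLowerBoundF11.lean`, `FiniteFieldLowerBoundF19.lean` — the last by the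
kernel-evaluated colouring search of `KernelColouringSearch.lean`) and, for the one open field, `5 ≤ χ ≤ 7` for every field with 27 elements
(`UnitQuadranceF27Colouring.lean`, `UnitQuadranceF27Hoffman.lean`).  What is NOT kernel: `χ ≥ 6` for `23, 31, 43, 47` (exact certificates outside
Lean, typed in `UnitQuadranceIndependence.lean`) and the open `χ(unitCircleGraph F₂₇) ≥ 6`.
-/

namespace Summit.Ventures.DiscreteObjects.UnitDistance

open SimpleGraph

/-- ATLAS KILLER VALUES, KERNEL-EXACT: `χ(UD(F₃²)) = 3`, `χ(UD(F₇²)) = 4`, `χ(UD(F₁₁²)) = 5`, `χ(UD(F₁₉²)) = 5`, and for every field `F` with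
27 elements `5 ≤ χ(UD(F²)) ≤ 7` (the value at `q = 27` — 5, 6 or 7 — is the one open entry of the order-1 atlas). -/
theorem atlas_killer_values_kernel :
    (unitCircleGraph (ZMod 3)).chromaticNumber = 3 ∧ (unitCircleGraph (ZMod 7)).chromaticNumber = 4 ∧
      (unitCircleGraph (ZMod 11)).chromaticNumber = 5 ∧ (unitCircleGraph (ZMod 19)).chromaticNumber = 5 ∧
      ∀ (F : Type) [Field F] [Fintype F], Fintype.card F = 27 →
        (5 : ℕ∞) ≤ (unitCircleGraph F).chromaticNumber ∧ (unitCircleGraph F).chromaticNumber ≤ 7 :=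
  ⟨chromaticNumber_unitCircleGraph_zmod3, chromaticNumber_unitCircleGraph_zmod7, chromaticNumber_unitCircleGraph_zmod11,
    chromaticNumber_unitCircleGraph_zmod19, fun F _ _ hF => chromaticNumber_unitCircleGraph_mem_Icc_of_card_eq_27 F hF⟩

/-- Corollary in the census vocabulary: none of the four killer residue fields allows a 6-chromatic unit-distance graph — any commutative ring `A`
with a ring homomorphism to `ZMod p`, `p ∈ {3, 7, 11, 19}`, has a 5-colourable unit-circle graph (so every unit-distance graph with coordinates in
`A` is 5-colourable, `colorable_of_ringHom_unitCircleGraph`). -/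
theorem unitCircleGraph_colorable_five_of_ringHom_killer {A : Type*} [CommRing A] {p : ℕ} (hp : p = 3 ∨ p = 7 ∨ p = 11 ∨ p = 19)
    (ρ : A →+* ZMod p) : (unitCircleGraph A).Colorable 5 := by
  rcases hp with rfl | rfl | rfl | rfl
  · haveI : Fact (1 < 3) := ⟨by norm_num⟩
    exact unitCircleGraph_colorable_of_ringHom ρ (unitCircleGraph_zmod3_colorable_three.mono (by norm_num))
  · haveI : Fact (1 < 7) := ⟨by norm_num⟩
    exact unitCircleGraph_colorable_of_ringHom ρ (unitCircleGraph_zmod7_colorable_four.mono (by norm_num))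
  · haveI : Fact (1 < 11) := ⟨by norm_num⟩
    exact unitCircleGraph_colorable_of_ringHom ρ unitCircleGraph_zmod11_colorable_five
  · haveI : Fact (1 < 19) := ⟨by norm_num⟩
    exact unitCircleGraph_colorable_of_ringHom ρ unitCircleGraph_zmod19_colorable_five

end Summit.Ventures.DiscreteObjects.UnitDistance
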